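import Summits.HodgeConjecture.HodgeCM.Model.LevelTranslate
import Summits.HodgeConjecture.HodgeCM.Model.Universe
import Literature.AlgebraicGeometry.ShimuraVarieties.UnitaryBallQuotientKaehlerClassCompatibility
import HarnessLib

/-!
# (Ω) The Kähler class system is preserved by the Hecke translates and the level coverings of the Picard modular tower

Fan A, binder `h413` ([Liu 2021, Prop. 4.13]), junction «Matsushima at the pin», row III-4′(b) piece (b6)/(Ω) (A-p10's class-sum
consumes it): the named fact `BallQuotientKaehlerClassSystem` (row B3-25 (b2), `UnitaryBallQuotientKaehlerClass.lean`; print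
`ω_X = c₁(K_X)`) hands a rational Kähler class `ω_X ∈ H²(X(ℂ); ℚ)` on every compact unitary ball quotient, pulled back to itself by
every morphism lying over an isometry of the balls (clause (ii), API `pull_omega_of_mem_realPoints` / `pull_omega_of_Hℂ_eq`).
The two junction lemmas of the model — `LevelTranslate.map_transMor_unif` («`t_γ(ℂ) (unif₁ v) = unif₂ (γ^{ι₁} v)`», `γ ∈ U(V)(L₀)`)
and `CoverInstance.map_levelCover_unif` («`levelCover(ℂ) ∘ unif' = unif`») — together with the two model facts «all levels of one `V`
carry the same complex Gram matrix `V.Hm^{ι₁}`» (`CoverInstance.ballDatum_Hℂ_eq`) and «`γ^{ι₁} ∈ U(V.Hm^{ι₁})`»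
(`LevelTranslate.map_ι₁_mem_realPoints`) give, in the anisotropic regime (`IsAnisotropic L V.Hm`, automatic for `[L:ℚ] ≠ 2`):

* (Ω2) `pull_transMor_omega` — `t_γ^* ω_{X_{Δ₂}} = ω_{X_{Δ₁}}` for the rational translate `t_γ : X_{Δ₁} ⟶ X_{Δ₂}`;
* (Ω1) `pull_levelCover_omega` — `levelCover^* ω_{X_Δ} = ω_{X_{Δ'}}` for `Δ' ≤ Δ`;
* the same in the end-state currency `U.pullC` on `(1 : ℂ) ⊗ₜ ω` (`pullC_transMorU_one_tmul_omega`, `pullC_levelCover_one_tmul_omega`), which is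
  what the `ω`-normalised Hodge–Riemann level forms (`BettiUniverse.exists_hrFormOne`, p600854) are built from.

HC_CM is proved only modulo the 7 printed citations until rung 0 closes; this file proves nothing about them (it consumes the
named fact `BallQuotientKaehlerClassSystem` as an explicit hypothesis `hΩ`).
-/

noncomputable section

open scoped Matrix TensorProduct
open Matrix Function Set
open NumberField CategoryTheory
open Literature.AlgebraicGeometry.Motives
open Literature.AlgebraicGeometry.ShimuraVarieties
open Literature.AlgebraicGeometry.HodgeTheory
open Literature.NumberTheory.Automorphic
open Literature.NumberTheory.Automorphic.PicardCM
open Literature.NumberTheory.Transcendental (Arapura2012_Cor_15_4_6)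

namespace HodgeCM

namespace Model.LevelTranslate

variable (hU : BallQuotientUniformisedDatum) (h₃ : CMAbelianVarietyRealised)
variable {L : CMField} {ι₁ : L →+* ℂ} {V : HermSpace3 L ι₁}

/-- **(Ω2) The rational translates preserve the Kähler class system**: for `γ ∈ U(V)(L₀)` translating `Δ₁` into `Δ₂`,
`t_γ^* ω_{X_{Δ₂}} = ω_{X_{Δ₁}}` in `H²(X_{Δ₁}(ℂ); ℚ)` — clause (ii) of `BallQuotientKaehlerClassSystem` at the isometry `γ^{ι₁} ∈ U(V.Hm^{ι₁})`
(`map_ι₁_mem_realPoints`), the common Gram matrix of the two levels (`ballDatum_Hℂ_eq`) and the junction `map_transMor_unif`.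
[cite: Kollar1995ShafarevichMaps, Ch. 5 Thm. 5.22 pp. 69–70] [cite: Hartshorne1977, II Prop. 8.11 p. 176; III Ex. 10.3 p. 275] -/
theorem pull_transMor_omega (hHD : exists_isReal_hodgeModel) (hA : Arapura2012_Cor_15_4_6) (hΩ : BallQuotientKaehlerClassSystem)
    {γ : GL (Fin 3) L} (hγ : γ ∈ Urat V) {Δ₁ Δ₂ : Level V} (ht : TransCond γ Δ₁ Δ₂) (h : IsAnisotropic L V.Hm) :
    BettiUniverse.pull (transMor hU h₃ hHD hA hγ Δ₁ Δ₂ ht) 2 (hΩ.omega (Var.scheme hU h₃ (.pms (pmsCode L ι₁ V Δ₂)))) =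
      hΩ.omega (Var.scheme hU h₃ (.pms (pmsCode L ι₁ V Δ₁))) :=
  hΩ.pull_omega_of_mem_realPoints
    (Var.ballDatum hU h₃ (pmsCode L ι₁ V Δ₂) ((isAnisotropic_pmsCode_iff L ι₁ V Δ₂).2 h))
    (Var.ballDatum hU h₃ (pmsCode L ι₁ V Δ₁) ((isAnisotropic_pmsCode_iff L ι₁ V Δ₁).2 h))
    (ballDatum_Hℂ_eq hU h₃ Δ₂ Δ₁ _ _) (map_ι₁_mem_realPoints hU h₃ hγ Δ₂ _) _
    fun _ hv ↦ map_transMor_unif hU h₃ hHD hA hγ ht h hv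

/-- **(Ω1) The level coverings preserve the Kähler class system**: for `Δ' ≤ Δ` (in `GL₃(L)`),
`levelCover^* ω_{X_Δ} = ω_{X_{Δ'}}` — clause (ii) at `g = 1` (`pull_omega_of_Hℂ_eq`) and the junction `map_levelCover_unif`.
[cite: Kollar1995ShafarevichMaps, Ch. 5 Thm. 5.22 pp. 69–70] [cite: Hartshorne1977, II Prop. 8.11 p. 176; III Ex. 10.3 p. 275] -/
theorem pull_levelCover_omega (hHD : exists_isReal_hodgeModel) (hA : Arapura2012_Cor_15_4_6) (hΩ : BallQuotientKaehlerClassSystem)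
    {Δ Δ' : Level V} (hle : Δ'.Γ ≤ Δ.Γ) (h : IsAnisotropic L V.Hm) :
    BettiUniverse.pull (levelCover hU h₃ hHD hA Δ Δ' hle) 2 (hΩ.omega (Var.scheme hU h₃ (.pms (pmsCode L ι₁ V Δ)))) =
      hΩ.omega (Var.scheme hU h₃ (.pms (pmsCode L ι₁ V Δ'))) :=
  hΩ.pull_omega_of_Hℂ_eq
    (Var.ballDatum hU h₃ (pmsCode L ι₁ V Δ) ((isAnisotropic_pmsCode_iff L ι₁ V Δ).2 h))
    (Var.ballDatum hU h₃ (pmsCode L ι₁ V Δ') ((isAnisotropic_pmsCode_iff L ι₁ V Δ').2 h))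
    (ballDatum_Hℂ_eq hU h₃ Δ Δ' _ _) _ fun _ hv ↦ map_levelCover_unif hU h₃ hHD hA hle h hv

/-! ## In the end-state currency `U.pullC` (complexified classes `(1 : ℂ) ⊗ₜ ω`) -/

section EndState

variable (hHD : exists_isReal_hodgeModel) (hI : hodgePQ_independent_of_hodgeModel) (hA : Arapura2012_Cor_15_4_6)

/-- (Ω2) in `U.pullC` currency: `t_γ^* (1 ⊗ ω_{Δ₂}) = 1 ⊗ ω_{Δ₁}`.
[cite: Kollar1995ShafarevichMaps, Ch. 5 Thm. 5.22 pp. 69–70] -/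
theorem pullC_transMorU_one_tmul_omega (hΩ : BallQuotientKaehlerClassSystem) {γ : GL (Fin 3) L} (hγ : γ ∈ Urat V)
    {Δ₁ Δ₂ : Level V} (ht : TransCond γ Δ₁ Δ₂) (h : IsAnisotropic L V.Hm) :
    (universeOf hHD hI hU h₃).pullC (transMorU hU h₃ hHD hI hA hγ Δ₁ Δ₂ ht) 2
        ((1 : ℂ) ⊗ₜ[ℚ] hΩ.omega (Var.scheme hU h₃ (.pms (pmsCode L ι₁ V Δ₂)))) =
      (1 : ℂ) ⊗ₜ[ℚ] hΩ.omega (Var.scheme hU h₃ (.pms (pmsCode L ι₁ V Δ₁))) := by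
  show (BettiUniverse.pull (transMor hU h₃ hHD hA hγ Δ₁ Δ₂ ht) 2).baseChange ℂ
      ((1 : ℂ) ⊗ₜ[ℚ] hΩ.omega (Var.scheme hU h₃ (.pms (pmsCode L ι₁ V Δ₂)))) =
    (1 : ℂ) ⊗ₜ[ℚ] hΩ.omega (Var.scheme hU h₃ (.pms (pmsCode L ι₁ V Δ₁)))
  rw [LinearMap.baseChange_tmul, pull_transMor_omega hU h₃ hHD hA hΩ hγ ht h]

/-- (Ω1) in `U.pullC` currency: `levelCover^* (1 ⊗ ω_Δ) = 1 ⊗ ω_{Δ'}`. [cite: Kollar1995ShafarevichMaps, Ch. 5 Thm. 5.22 pp. 69–70] -/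
theorem pullC_levelCover_one_tmul_omega (hΩ : BallQuotientKaehlerClassSystem) {Δ Δ' : Level V} (hle : Δ'.Γ ≤ Δ.Γ)
    (h : IsAnisotropic L V.Hm) :
    (universeOf hHD hI hU h₃).pullC (levelCover hU h₃ hHD hA Δ Δ' hle) 2
        ((1 : ℂ) ⊗ₜ[ℚ] hΩ.omega (Var.scheme hU h₃ (.pms (pmsCode L ι₁ V Δ)))) =
      (1 : ℂ) ⊗ₜ[ℚ] hΩ.omega (Var.scheme hU h₃ (.pms (pmsCode L ι₁ V Δ'))) := by
  show (BettiUniverse.pull (levelCover hU h₃ hHD hA Δ Δ' hle) 2).baseChange ℂ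
      ((1 : ℂ) ⊗ₜ[ℚ] hΩ.omega (Var.scheme hU h₃ (.pms (pmsCode L ι₁ V Δ)))) =
    (1 : ℂ) ⊗ₜ[ℚ] hΩ.omega (Var.scheme hU h₃ (.pms (pmsCode L ι₁ V Δ')))
  rw [LinearMap.baseChange_tmul, pull_levelCover_omega hU h₃ hHD hA hΩ hle h]

/-- The Kähler class of each level surface is a Kähler class (clause (i) of the fact at the model's ball datum) — the positivity input of the
`ω`-normalised Hodge–Riemann form on `H¹(X_Δ)`. [cite: Kollar1995ShafarevichMaps, Ch. 5 Thm. 5.22 pp. 69–70] [cite: VoisinHodgeI2002, §3.3.2 and Thm. 7.10] -/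
theorem isKaehlerClass_omega_level (hΩ : BallQuotientKaehlerClassSystem) (Δ : Level V) (h : IsAnisotropic L V.Hm) :
    IsKaehlerClass 2 (Var.scheme hU h₃ (.pms (pmsCode L ι₁ V Δ)))
      (ofRatClass (ComplexPoints (Var.scheme hU h₃ (.pms (pmsCode L ι₁ V Δ)))) 2
        (hΩ.omega (Var.scheme hU h₃ (.pms (pmsCode L ι₁ V Δ))))) :=
  hΩ.isKaehlerClass_omega (Var.ballDatum hU h₃ (pmsCode L ι₁ V Δ) ((isAnisotropic_pmsCode_iff L ι₁ V Δ).2 h))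

end EndState

end Model.LevelTranslate

end HodgeCM

end
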